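import Summits.BirchSwinnertonDyer.BirchSwinnertonDyer.Theorems.EisensteinPrimesAnalyticLambdaValueCongruence
import HarnessLib

/-!
# Route `EisensteinPrimes`, line `mudescent`, cruxes 3/5: the ABSOLUTE analytic `(μ, λ)`-count from a
# congruence with a UNIT power series times split-prime raising factors — the socket of THEOREM B
# (Pollack–Wake's prime-level cuspidal unit transferred to type-A twins; helper; THEOREMS ONLY)

Seat `bsd-eis-lam-a` g9 (PROGRAMME PART 1b, ACCEL-LIST (4): ANALYTIC side of
`stub_lambdaCount_offLocus`; items stmt-BirchSwinnertonDyer-19033 / -19035; skeleton owner bsd-eis-ky,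
`Lines/mudescent.lean`). No definition, no named fact, nothing about any particular curve; closes
nothing; moves no label.

WHAT AND WHY (HOME/lam-a-g9/lam-a-MEMO-9.md, THEOREM B). The predecessors' sockets
(`EisensteinPrimesAnalyticLambdaCongruenceTransfer`, `…ValueCongruence`) turn a congruence between the
`p`-adic `L`-functions of two TWINS into a RELATIVE count (`μ` transfers, `λ + Σδ = λ′ + Σδ′`). THEOREM B
(MEMO-9 §3) supplies, for the «Pollack–Wake twin family» — type-A étale ends `E` of squarefree conductor
whose `E[p]` is ramified at exactly one prime `q ≡ 1 (mod p)` with `p` not a `p`-th power mod `q`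
(`p ≥ 5`) —, a congruence of a NEW shape: `G_E ≡ u · U · ∏_{ℓ ∣ N, ℓ ∉ {p,q}, ℓ split} (1 − γ_ℓ)
· ∏_{ℓ non-split} (1 + γ_ℓ) (mod p)`, where `G_E ∈ Λ` is the Néron-normalised `p`-adic `L`-function,
`γ_ℓ = (1+T)^{f_ℓ}` the Frobenius of `ℓ` (tree `GreenbergVatsal2000.frobeniusSeries`) and `U ∈ Λˣ` is
a UNIT — the weight-2 specialisation of Pollack–Wake's cuspidal-normalised `L_p^+(𝔪, ω⁰)⁰_e`
(Tunis. J. Math. 7 (2025) Thm. 5.12 (1): a unit of `𝕋⁰_𝔪⟦u⟧`). Its consequence is an ABSOLUTE count: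
`μ(G_E) = 0` and `λ(G_E) = Σ_{ℓ split} s_ℓ`, `s_ℓ = p^{v_p(ℓ^{p−1}−1)−1} = p^{v_p(f_ℓ)}` (tree
`GreenbergVatsal2000.sFactor`). This file proves everything DOWNSTREAM of the congruence:

* §1 (`Λ`-algebra): `hasUnitContent_of_isUnit`, `hasUnitContent_and_lam_eq_of_truncCongr_unit_mul` —
  `G ≡ u·U·Q (mod p, T^K)`, `U` a unit, `Q` of unit content with `ord_T(Q̄) = d < K` ⟹ `G` has unit
  content and `λ(G) = d`; the same fed by VALUES at the `p`-power roots of unity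
  (`…_of_valueCongr_unit_mul`, via the Weierstrass step of `…ValueCongruence`).
* §2 (the raising factors): `order_map_toZMod_one_sub_frobeniusSeries` (`ord_T(1 − γ_ℓ mod p) = s_ℓ`),
  `isUnit_one_add_frobeniusSeries` (`1 + γ_ℓ ∈ Λˣ` for odd `p`), and for a finite set `S` of integers
  `> 1` prime to `p`: `hasUnitContent_and_order_prod_one_sub_frobeniusSeries`
  (`ord_T(∏_{ℓ∈S}(1 − γ_ℓ) mod p) = Σ_{ℓ∈S} s_ℓ`, unit content).
* §3 (X2 currency, crux 3): `X2.analyticMuLE_zero_and_analyticLambdaEq_of_truncCongr_unit`,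
  `…_of_valueCongr_unit`, and THEOREM B's instance
  `X2.analyticMuLE_zero_and_analyticLambdaEq_sum_sFactor_of_valueCongr`:
  `X2.AnalyticMuLE W p 0 ∧ X2.AnalyticLambdaEq W p (Σ_{ℓ∈S} s_ℓ)`.
* §4 (X1 currency, crux 5 / good ordinary rows): the same two statements for
  `X1.MuPart.AnalyticMuLE` / `X1.ParitySqueeze.AnalyticLambdaEq`.
* §5 (route T): `X2.mazurMainConjectureAt_of_valueCongr_unit_of_algebraicLambdaGE` — with Wuthrich
  2014 Thm. 16 and an algebraic budget `k ≥ Σ s_ℓ (−1 at a split p)`, THEOREM B's congruence gives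
  `X2.MazurMainConjectureAt W p` at the pair (both analytic inputs of the line `mudescent` supplied).

HONEST FRAMING. The congruence hypothesis (`hcong` / `hval`) is what MEMO-9 THEOREM B PROVES ON PAPER
(modulo Pollack–Wake 2025 Thm. 5.12, Mazur 1977 §II.11, Vatsal 2005 Thm. 1.1, Ohta 2014 Thm. (3.6.2),
Ribet's kernel of the degeneracy map) for the Pollack–Wake twin family; it is NOT asserted here — the
tree has no `J₀(N)` vocabulary. Numerically the conclusion holds on every member of record (p = 5:
49/49 for N ≤ 2·10⁴; p = 7: 4/4; the p = 3 analogue 138/138), MEMO-9 §4.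

References: [PollackWake2025] Thm. 5.12; [GreenbergVatsal2000] §1 (8)–(10), §2 Prop. (2.4);
[Washington1997] §7.1–7.2; HOME/lam-a-g9/lam-a-MEMO-9.md §3–§4.
-/

set_option linter.dupNamespace false
set_option autoImplicit false

noncomputable section

open scoped Classical MatrixGroups ModularForm

open PowerSeries CongruenceSubgroup WeierstrassCurve NumberField IsDedekindDomain
  Literature.NumberTheory.EllipticCurves
  Literature.NumberTheory.EllipticCurves.ModularForms
  Literature.NumberTheory.EllipticCurves.Rank1Residual
  Literature.NumberTheory.EllipticCurves.GreenbergVatsal2000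
  Summit.BirchSwinnertonDyer.Rank1Residual
  Summit.BirchSwinnertonDyer.Rank1Residual.X1.MuLambda
  Summit.BirchSwinnertonDyer.Rank1Residual.X11a
  Summit.BirchSwinnertonDyer.Rank1Residual.Iwasawa
  Summit.BirchSwinnertonDyer.Rank1Residual.X2.EulerFactorAlgebra
  Summit.BirchSwinnertonDyer.Rank1Residual.X2.EulerFactorInvariants
  Summit.BirchSwinnertonDyer.Rank1Residual.X2.GreenbergVatsalAnalyticTransferCore
  Summit.BirchSwinnertonDyer.BirchSwinnertonDyer.Theorems
  Summit.BirchSwinnertonDyer.BirchSwinnertonDyer.Theorems.EisensteinPrimesAnalyticLambdaCongruenceTransfer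
  Summit.BirchSwinnertonDyer.BirchSwinnertonDyer.Theorems.EisensteinPrimesAnalyticLambdaValueCongruence
  Summit.BirchSwinnertonDyer.BirchSwinnertonDyer.Theorems.EisensteinPrimesX2AnalyticLambdaResultantCertificate

namespace Summit.BirchSwinnertonDyer.BirchSwinnertonDyer.Theorems.EisensteinPrimesAnalyticLambdaAbsoluteCount

variable {p : ℕ} [hp : Fact p.Prime]

/-! ## §1. `Λ`-algebra: congruence with (unit) × (unit-content multiplier) gives `μ = 0` and `λ` -/

section Algebra

/-- A unit of `Λ = ℤ_p⟦T⟧` has unit content (`μ = 0`). [folklore] -/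
theorem hasUnitContent_of_isUnit {U : IwasawaAlgebra p} (hU : IsUnit U) : HasUnitContent U := by
  obtain ⟨hU0, hμ, -⟩ := (isUnit_iff_mu_eq_zero_and_lam_eq_zero U).mp hU
  exact hasUnitContent_of_mu_eq_zero hU0 hμ

/-- The reduction of `1 ∈ Λ` has `T`-order `0`. [folklore] -/
theorem order_map_toZMod_one :
    (PowerSeries.map (PadicInt.toZMod (p := p)) (1 : IwasawaAlgebra p)).order = ((0 : ℕ) : ℕ∞) := by
  rw [map_one, PowerSeries.order_one, Nat.cast_zero]

/-- **Congruence with a unit times a multiplier ⟹ `μ = 0` and `λ = ord_T` of the multiplier.** If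
`[T^j]Ḡ = u·[T^j](U·Q)‾` in `𝔽_p` for all `j < K`, with `u ≠ 0`, `U ∈ Λˣ`, `Q` of unit content and
`ord_T Q̄ = d < K`, then `G` has unit content (`μ(G) = 0`) and `λ(G) = d` — the shape in which
THEOREM B delivers the absolute count (`U` = Pollack–Wake's cuspidal unit, `Q` = the raising factors).
[cite: GreenbergVatsal2000, §1 (9)–(10)] [cite: Washington1997, §7.1] -/
theorem hasUnitContent_and_lam_eq_of_truncCongr_unit_mul {G U Q : IwasawaAlgebra p} (hU : IsUnit U)
    (hQ : HasUnitContent Q) {d : ℕ} (hd : (PowerSeries.map (PadicInt.toZMod (p := p)) Q).order = d)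
    {u : ZMod p} (hu : u ≠ 0) {K : ℕ}
    (hcong : ∀ j < K, PowerSeries.coeff j (PowerSeries.map (PadicInt.toZMod (p := p)) G) =
      u * PowerSeries.coeff j (PowerSeries.map (PadicInt.toZMod (p := p)) (U * Q)))
    (hK : d < K) : HasUnitContent G ∧ lam G = d := by
  have hcong' : ∀ j < K, PowerSeries.coeff j (PowerSeries.map (PadicInt.toZMod (p := p)) (G * 1)) =
      u * PowerSeries.coeff j (PowerSeries.map (PadicInt.toZMod (p := p)) (U * Q)) := by
    intro j hj; rw [mul_one]; exact hcong j hj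
  have hK' : lam U + d < K := by rw [X1.ParitySqueeze.lam_eq_zero_of_isUnit hU, zero_add]; exact hK
  obtain ⟨hG, h⟩ := hasUnitContent_and_lam_add_eq_of_truncCongr_mul order_map_toZMod_one hQ hd hu
    hcong' (hasUnitContent_of_isUnit hU) hK'
  rw [X1.ParitySqueeze.lam_eq_zero_of_isUnit hU, zero_add, add_zero] at h
  exact ⟨hG, h⟩

/-- **The same fed by VALUES at the `p`-power roots of unity** (the currency THEOREM B actually
produces: `G(ζ − 1) ≡ c·(U·Q)(ζ − 1) (mod p)` for all primitive `p^{m+1}`-th roots `ζ`, `m ≥ n₀`, one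
unit `c ∈ ℤ_p`): then `μ(G) = 0` and `λ(G) = ord_T Q̄`. [cite: Washington1997, §7.1–7.2, Thm. 7.3] -/
theorem hasUnitContent_and_lam_eq_of_valueCongr_unit_mul {G U Q : IwasawaAlgebra p} (hU : IsUnit U)
    (hQ : HasUnitContent Q) {d : ℕ} (hd : (PowerSeries.map (PadicInt.toZMod (p := p)) Q).order = d)
    {c : ℤ_[p]} (hc : IsUnit c) {n₀ : ℕ}
    (hval : ∀ m : ℕ, n₀ ≤ m → ∀ ζ : ℂ_[p], IsPrimitiveRoot ζ (p ^ (m + 1)) →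
      ‖∑' k, ((algebraMap ℚ_[p] ℂ_[p]).comp (algebraMap ℤ_[p] ℚ_[p]))
          (PowerSeries.coeff k (G - PowerSeries.C c * (U * Q))) * (ζ - 1) ^ k‖ ≤ (p : ℝ)⁻¹) :
    HasUnitContent G ∧ lam G = d :=
  hasUnitContent_and_lam_eq_of_truncCongr_unit_mul hU hQ hd
    (EisensteinPrimesAnalyticLambdaValueCongruence.toZMod_ne_zero_of_isUnit hc) (K := d + 1)
    (fun j _ ↦ EisensteinPrimesAnalyticLambdaValueCongruence.forall_coeff_toZMod_eq_of_forall_norm_tsum_le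
      hval j) (Nat.lt_succ_self d)

end Algebra

/-! ## §2. The raising factors `1 ∓ γ_ℓ`, `γ_ℓ = (1+T)^{f_ℓ}`: orders `s_ℓ` and units -/

section Raising

/-- **`ord_T((1 − γ_ℓ) mod p) = s_ℓ`** for an integer `ℓ > 1` prime to the odd prime `p`
(`γ_ℓ = (1+T)^{f_ℓ}`; `s_ℓ = p^{v_p(f_ℓ)} = p^{v_p(ℓ^{p−1}−1)−1}` = the number of primes of `ℚ_∞`
above `ℓ`): the `λ`-invariant of the factor by which THEOREM B raises the prime-level form at a SPLIT
multiplicative prime of the elliptic twin. [cite: GreenbergVatsal2000, §2 Prop. (2.4) (s_ℓ)] -/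
theorem order_map_toZMod_one_sub_frobeniusSeries (hp2 : p ≠ 2) {ℓ : ℕ} (hℓ : p.Coprime ℓ)
    (h1 : 1 < ℓ) :
    (PowerSeries.map (PadicInt.toZMod (p := p)) (1 - frobeniusSeries p ℓ)).order = sFactor p ℓ := by
  rw [map_sub, map_one, ← PowerSeries.order_neg, neg_sub, frobeniusSeries_eq,
    order_map_binomialSeries_sub_one p (frobeniusExponent_natCast_ne_zero hℓ h1),
    ← pow_valuation_frobeniusExponent_eq_sFactor hp2 hℓ h1, Nat.cast_pow]

/-- `1 − γ_ℓ` has unit content (`μ = 0`), `ℓ > 1` prime to the odd prime `p`. [cite: GreenbergVatsal2000, §2 Prop. (2.4) (μ = 0)] -/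
theorem hasUnitContent_one_sub_frobeniusSeries (hp2 : p ≠ 2) {ℓ : ℕ} (hℓ : p.Coprime ℓ) (h1 : 1 < ℓ) :
    HasUnitContent (1 - frobeniusSeries p ℓ) := by
  rw [hasUnitContent_iff_map_toZMod_ne_zero]
  intro h
  have := order_map_toZMod_one_sub_frobeniusSeries hp2 hℓ h1
  rw [h, PowerSeries.order_zero] at this
  exact ENat.top_ne_coe _ this

/-- **`1 + γ_ℓ ∈ Λˣ` for odd `p`** (constant coefficient `2`): the raising factor at a NON-SPLIT prime
of the elliptic twin is a unit, so it contributes nothing to `λ`. [folklore] -/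
theorem isUnit_one_add_frobeniusSeries (hp2 : p ≠ 2) (ℓ : ℕ) : IsUnit (1 + frobeniusSeries p ℓ) := by
  rw [PowerSeries.isUnit_iff_constantCoeff, map_add, map_one, frobeniusSeries_eq,
    ← PowerSeries.coeff_zero_eq_constantCoeff_apply, PowerSeries.binomialSeries_coeff,
    Ring.choose_zero_right, one_smul]
  have h2 : ((2 : ℕ) : ℤ_[p]) = 1 + 1 := by norm_num
  rw [← h2]
  exact isUnit_natCast_of_coprime ((Nat.coprime_primes hp.out Nat.prime_two).mpr hp2)

/-- **`ord_T(∏_{ℓ∈S}(1 − γ_ℓ) mod p) = Σ_{ℓ∈S} s_ℓ`** and the product has unit content, for a finite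
set `S` of integers `> 1` prime to the odd prime `p` (intended: the split multiplicative primes
`ℓ ∉ {p, q}` of the elliptic twin). [cite: GreenbergVatsal2000, §1 (9) and §2 Prop. (2.4)] -/
theorem hasUnitContent_and_order_prod_one_sub_frobeniusSeries (hp2 : p ≠ 2) (S : Finset ℕ)
    (hS : ∀ ℓ ∈ S, p.Coprime ℓ ∧ 1 < ℓ) :
    HasUnitContent (∏ ℓ ∈ S, (1 - frobeniusSeries p ℓ)) ∧
      (PowerSeries.map (PadicInt.toZMod (p := p)) (∏ ℓ ∈ S, (1 - frobeniusSeries p ℓ))).order =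
        ((∑ ℓ ∈ S, sFactor p ℓ : ℕ) : ℕ∞) := by
  induction S using Finset.induction_on with
  | empty =>
    refine ⟨?_, ?_⟩
    · rw [Finset.prod_empty, hasUnitContent_iff_map_toZMod_ne_zero, map_one]; exact one_ne_zero
    · rw [Finset.prod_empty, Finset.sum_empty]; exact order_map_toZMod_one
  | insert a S ha ih =>
    have hS' : ∀ ℓ ∈ S, p.Coprime ℓ ∧ 1 < ℓ := fun ℓ hℓ ↦ hS ℓ (Finset.mem_insert_of_mem hℓ)
    obtain ⟨hu, hord⟩ := ih hS'
    obtain ⟨hcop, h1⟩ := hS a (Finset.mem_insert_self a S)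
    refine ⟨?_, ?_⟩
    · rw [Finset.prod_insert ha, hasUnitContent_mul_iff]
      exact ⟨hasUnitContent_one_sub_frobeniusSeries hp2 hcop h1, hu⟩
    · rw [Finset.prod_insert ha, Finset.sum_insert ha, map_mul, PowerSeries.order_mul,
        order_map_toZMod_one_sub_frobeniusSeries hp2 hcop h1, hord, Nat.cast_add]

end Raising

/-! ## §3. X2 currency (crux 3, `p ‖ N`): the absolute `(μ, λ)` at the target from the unit congruence -/

section X2

variable {W : WeierstrassCurve ℚ} [W.IsElliptic] [W.IsGloballyMinimal]
  {N : ℕ} [NeZero N] {f : CuspForm (Gamma0 N) 2} {ϖ : ℚ} {L : PowerSeries ℚ_[p]}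

/-- **X2: `μ_an(W) = 0` and `λ_an(W) = d` from ONE truncated congruence with a unit times a multiplier.**
Data: `(f, ϖ, L)` the datum of `X2.AnalyticMuLE` / `X2.AnalyticLambdaEq` at `(W, p)` (odd multiplicative
`p`) with an integral model `ι(G) = ϖ·L`; a unit `U ∈ Λˣ` (intended: the weight-2 specialisation of
Pollack–Wake's cuspidal-normalised `L_p^+(𝔪, ω⁰)⁰_e`, a unit by Tunis. J. Math. 7 (2025) Thm. 5.12 (1));
a multiplier `Q` of unit content and reduced `T`-order `d` (intended: `∏(1 ∓ γ_ℓ)` over the bad primes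
`ℓ ∉ {p, q}`); the DISPLAYED hypothesis `[T^j]Ḡ = u·[T^j](U·Q)‾` for `j < K`, `u ≠ 0`, `d < K`.
Conclusion: `X2.AnalyticMuLE W p 0 ∧ X2.AnalyticLambdaEq W p d` (trivial zero included in `d`).
[cite: PollackWake2025, Thm. 5.12 (1)] [cite: GreenbergVatsal2000, §1 (9)–(10)] [cite: Washington1997, §7.1] -/
theorem X2.analyticMuLE_zero_and_analyticLambdaEq_of_truncCongr_unit (hf : IsNewformOf W f)
    (hϖ : (ϖ : ℝ) * W.realPeriodRat = plusPeriod f)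
    (hLs : W.HasSplitMultiplicativeReductionAtPrime p → IsSplitMultPAdicLFunctionOf f p L)
    (hLn : ¬ W.HasSplitMultiplicativeReductionAtPrime p → IsMultPAdicLFunctionOf f p (-1) L)
    {G : IwasawaAlgebra p} (hG : iwasawaToPowerSeries p G = PowerSeries.C ((ϖ : ℚ) : ℚ_[p]) * L)
    {U Q : IwasawaAlgebra p} (hU : IsUnit U) (hQ : HasUnitContent Q) {d : ℕ}
    (hd : (PowerSeries.map (PadicInt.toZMod (p := p)) Q).order = d) {u : ZMod p} (hu : u ≠ 0)
    {K : ℕ}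
    (hcong : ∀ j < K, PowerSeries.coeff j (PowerSeries.map (PadicInt.toZMod (p := p)) G) =
      u * PowerSeries.coeff j (PowerSeries.map (PadicInt.toZMod (p := p)) (U * Q)))
    (hK : d < K) : X2.AnalyticMuLE W p 0 ∧ X2.AnalyticLambdaEq W p d := by
  obtain ⟨hGu, hlamG⟩ := hasUnitContent_and_lam_eq_of_truncCongr_unit_mul hU hQ hd hu hcong hK
  obtain ⟨k, hk⟩ := (hasUnitContent_iff_exists_norm_eq_one G).mp hGu
  rw [EisensteinPrimesX2AnalyticLambdaCertificate.norm_coeff_eq_of_iota_eq hG] at hk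
  refine ⟨EisensteinPrimesX2AnalyticLambdaCertificate.analyticMuLE_zero_of_norm_coeff_eq_one hf hϖ
      hLs hLn hk,
    (EisensteinPrimesX2AnalyticLambdaCertificate.analyticLambdaEq_iff_of_datum hf hϖ hLs hLn
      d).mpr fun G₁ hG₁ ↦ ?_⟩
  rw [iwasawaToPowerSeries_injective p (hG₁.trans hG.symm), hlamG]

/-- **X2, fed by VALUES** (THEOREM B's output currency: one unit `c ∈ ℤ_p` and
`‖(G − C(c)·U·Q)(ζ − 1)‖ ≤ 1/p` at every primitive `p^{m+1}`-th root of unity, `m ≥ n₀`).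
Conclusion: `X2.AnalyticMuLE W p 0 ∧ X2.AnalyticLambdaEq W p d`.
[cite: PollackWake2025, Thm. 5.12 (1)] [cite: Washington1997, §7.1–7.2, Thm. 7.3] -/
theorem X2.analyticMuLE_zero_and_analyticLambdaEq_of_valueCongr_unit (hf : IsNewformOf W f)
    (hϖ : (ϖ : ℝ) * W.realPeriodRat = plusPeriod f)
    (hLs : W.HasSplitMultiplicativeReductionAtPrime p → IsSplitMultPAdicLFunctionOf f p L)
    (hLn : ¬ W.HasSplitMultiplicativeReductionAtPrime p → IsMultPAdicLFunctionOf f p (-1) L)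
    {G : IwasawaAlgebra p} (hG : iwasawaToPowerSeries p G = PowerSeries.C ((ϖ : ℚ) : ℚ_[p]) * L)
    {U Q : IwasawaAlgebra p} (hU : IsUnit U) (hQ : HasUnitContent Q) {d : ℕ}
    (hd : (PowerSeries.map (PadicInt.toZMod (p := p)) Q).order = d) {c : ℤ_[p]} (hc : IsUnit c)
    {n₀ : ℕ}
    (hval : ∀ m : ℕ, n₀ ≤ m → ∀ ζ : ℂ_[p], IsPrimitiveRoot ζ (p ^ (m + 1)) →
      ‖∑' k, ((algebraMap ℚ_[p] ℂ_[p]).comp (algebraMap ℤ_[p] ℚ_[p]))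
          (PowerSeries.coeff k (G - PowerSeries.C c * (U * Q))) * (ζ - 1) ^ k‖ ≤ (p : ℝ)⁻¹) :
    X2.AnalyticMuLE W p 0 ∧ X2.AnalyticLambdaEq W p d :=
  X2.analyticMuLE_zero_and_analyticLambdaEq_of_truncCongr_unit hf hϖ hLs hLn hG hU hQ hd
    (EisensteinPrimesAnalyticLambdaValueCongruence.toZMod_ne_zero_of_isUnit hc) (K := d + 1)
    (fun j _ ↦ EisensteinPrimesAnalyticLambdaValueCongruence.forall_coeff_toZMod_eq_of_forall_norm_tsum_le
      hval j) (Nat.lt_succ_self d)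

/-- **THEOREM B's instance (X2 currency): `μ_an(W) = 0` and `λ_an(W) = Σ_{ℓ∈S} s_ℓ`.** With the
multiplier `Q = ∏_{ℓ∈S}(1 − γ_ℓ)` over a finite set `S` of integers `> 1` prime to the odd prime `p`
(intended: the SPLIT multiplicative primes `ℓ ∉ {p, q}` of `W`; the non-split factors `1 + γ_ℓ` are
units, `isUnit_one_add_frobeniusSeries`, and are absorbed in `U`), a unit `U ∈ Λˣ` and the value
congruence `G(ζ−1) ≡ c·(U·Q)(ζ−1) (mod p)` at all primitive `p`-power roots of unity of level `> n₀`: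
`X2.AnalyticMuLE W p 0 ∧ X2.AnalyticLambdaEq W p (Σ_{ℓ∈S} s_ℓ)` — the Greenberg–Vatsal-type ABSOLUTE
count on ¬GVPar rows predicted by THEOREM B (trivial zero at a split `p` INCLUDED in the sum; MEMO-9
§4: 49/49 @5, 4/4 @7, 138/138 @3 on the members of record).
[cite: PollackWake2025, Thm. 5.12 (1)] [cite: GreenbergVatsal2000, §1 (9), §2 Prop. (2.4)] -/
theorem X2.analyticMuLE_zero_and_analyticLambdaEq_sum_sFactor_of_valueCongr (hp2 : p ≠ 2)
    (hf : IsNewformOf W f) (hϖ : (ϖ : ℝ) * W.realPeriodRat = plusPeriod f)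
    (hLs : W.HasSplitMultiplicativeReductionAtPrime p → IsSplitMultPAdicLFunctionOf f p L)
    (hLn : ¬ W.HasSplitMultiplicativeReductionAtPrime p → IsMultPAdicLFunctionOf f p (-1) L)
    {G : IwasawaAlgebra p} (hG : iwasawaToPowerSeries p G = PowerSeries.C ((ϖ : ℚ) : ℚ_[p]) * L)
    {U : IwasawaAlgebra p} (hU : IsUnit U) (S : Finset ℕ) (hS : ∀ ℓ ∈ S, p.Coprime ℓ ∧ 1 < ℓ)
    {c : ℤ_[p]} (hc : IsUnit c) {n₀ : ℕ}
    (hval : ∀ m : ℕ, n₀ ≤ m → ∀ ζ : ℂ_[p], IsPrimitiveRoot ζ (p ^ (m + 1)) →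
      ‖∑' k, ((algebraMap ℚ_[p] ℂ_[p]).comp (algebraMap ℤ_[p] ℚ_[p]))
          (PowerSeries.coeff k (G - PowerSeries.C c * (U * ∏ ℓ ∈ S, (1 - frobeniusSeries p ℓ)))) *
            (ζ - 1) ^ k‖ ≤ (p : ℝ)⁻¹) :
    X2.AnalyticMuLE W p 0 ∧ X2.AnalyticLambdaEq W p (∑ ℓ ∈ S, sFactor p ℓ) := by
  obtain ⟨hQ, hd⟩ := hasUnitContent_and_order_prod_one_sub_frobeniusSeries hp2 S hS
  exact X2.analyticMuLE_zero_and_analyticLambdaEq_of_valueCongr_unit hf hϖ hLs hLn hG hU hQ hd hc hval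

end X2

/-! ## §4. X1 currency (crux 5, good ordinary rows): the same -/

section X1

variable {W : WeierstrassCurve ℚ} [W.IsElliptic] [W.IsGloballyMinimal] [NeZero (W.conductorNorm ℤ)]
  {f : CuspForm (Gamma0 (W.conductorNorm ℤ)) 2} {ϖ : ℚ}

/-- **X1: `X1.MuPart.AnalyticMuLE W p 0 ∧ X1.ParitySqueeze.AnalyticLambdaEq W p d` from ONE truncated
congruence with a unit times a multiplier** (good ordinary target; `ι(G) = ϖ·L_p(f, α)`, `α` the unit
root). [cite: PollackWake2025, Thm. 5.12 (1)] [cite: GreenbergVatsal2000, §1 (9)–(10)] [cite: Washington1997, §7.1] -/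
theorem X1.analyticMuLE_zero_and_analyticLambdaEq_of_truncCongr_unit (hf : IsNewformOf W f)
    (hϖ : (ϖ : ℝ) * W.realPeriodRat = plusPeriod f) {G : IwasawaAlgebra p}
    (hG : iwasawaToPowerSeries p G =
      PowerSeries.C (ϖ : ℚ_[p]) * padicLFunction f (unitRoot W p : ℚ_[p]))
    {U Q : IwasawaAlgebra p} (hU : IsUnit U) (hQ : HasUnitContent Q) {d : ℕ}
    (hd : (PowerSeries.map (PadicInt.toZMod (p := p)) Q).order = d) {u : ZMod p} (hu : u ≠ 0)
    {K : ℕ}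
    (hcong : ∀ j < K, PowerSeries.coeff j (PowerSeries.map (PadicInt.toZMod (p := p)) G) =
      u * PowerSeries.coeff j (PowerSeries.map (PadicInt.toZMod (p := p)) (U * Q)))
    (hK : d < K) : X1.MuPart.AnalyticMuLE W p 0 ∧ X1.ParitySqueeze.AnalyticLambdaEq W p d := by
  obtain ⟨hGu, hlamG⟩ := hasUnitContent_and_lam_eq_of_truncCongr_unit_mul hU hQ hd hu hcong hK
  obtain ⟨k, hk⟩ := (hasUnitContent_iff_exists_norm_eq_one G).mp hGu
  rw [EisensteinPrimesX2AnalyticLambdaCertificate.norm_coeff_eq_of_iota_eq hG] at hk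
  refine ⟨EisensteinPrimesX1AnalyticLambdaCertificate.analyticMuLE_zero_of_norm_coeff_eq_one hf hϖ hk,
    (EisensteinPrimesX1AnalyticLambdaCertificate.analyticLambdaEq_iff_of_datum hf hϖ d).mpr
      fun G₁ hG₁ ↦ ?_⟩
  rw [iwasawaToPowerSeries_injective p (hG₁.trans hG.symm), hlamG]

/-- **X1, THEOREM B's instance fed by VALUES: `μ_an(W) = 0` and `λ_an(W) = Σ_{ℓ∈S} s_ℓ`** at a good
ordinary target, from a unit `U`, the multiplier `∏_{ℓ∈S}(1 − γ_ℓ)` (`S` = the split multiplicative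
primes `≠ q` of `W`, all `> 1` and prime to the odd `p`), and the value congruence at all primitive
`p`-power roots of unity of level `> n₀`. [cite: PollackWake2025, Thm. 5.12 (1)]
[cite: GreenbergVatsal2000, §1 (9), §2 Prop. (2.4)] [cite: Washington1997, §7.1–7.2, Thm. 7.3] -/
theorem X1.analyticMuLE_zero_and_analyticLambdaEq_sum_sFactor_of_valueCongr (hp2 : p ≠ 2)
    (hf : IsNewformOf W f) (hϖ : (ϖ : ℝ) * W.realPeriodRat = plusPeriod f) {G : IwasawaAlgebra p}
    (hG : iwasawaToPowerSeries p G =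
      PowerSeries.C (ϖ : ℚ_[p]) * padicLFunction f (unitRoot W p : ℚ_[p]))
    {U : IwasawaAlgebra p} (hU : IsUnit U) (S : Finset ℕ) (hS : ∀ ℓ ∈ S, p.Coprime ℓ ∧ 1 < ℓ)
    {c : ℤ_[p]} (hc : IsUnit c) {n₀ : ℕ}
    (hval : ∀ m : ℕ, n₀ ≤ m → ∀ ζ : ℂ_[p], IsPrimitiveRoot ζ (p ^ (m + 1)) →
      ‖∑' k, ((algebraMap ℚ_[p] ℂ_[p]).comp (algebraMap ℤ_[p] ℚ_[p]))
          (PowerSeries.coeff k (G - PowerSeries.C c * (U * ∏ ℓ ∈ S, (1 - frobeniusSeries p ℓ)))) *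
            (ζ - 1) ^ k‖ ≤ (p : ℝ)⁻¹) :
    X1.MuPart.AnalyticMuLE W p 0 ∧ X1.ParitySqueeze.AnalyticLambdaEq W p (∑ ℓ ∈ S, sFactor p ℓ) := by
  obtain ⟨hQ, hd⟩ := hasUnitContent_and_order_prod_one_sub_frobeniusSeries hp2 S hS
  exact X1.analyticMuLE_zero_and_analyticLambdaEq_of_truncCongr_unit hf hϖ hG hU hQ hd
    (EisensteinPrimesAnalyticLambdaValueCongruence.toZMod_ne_zero_of_isUnit hc) (K := _ + 1)
    (fun j _ ↦ EisensteinPrimesAnalyticLambdaValueCongruence.forall_coeff_toZMod_eq_of_forall_norm_tsum_le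
      hval j) (Nat.lt_succ_self _)

end X1

/-! ## §5. Route T fed by THEOREM B: Mazur's main conjecture at the pair from the unit congruence
and an algebraic budget `k ≥ Σ s_ℓ (− 1 at a split p)` -/

section RouteT

variable {W : WeierstrassCurve ℚ} [W.IsElliptic] [W.IsGloballyMinimal]
  {N : ℕ} [NeZero N] {f : CuspForm (Gamma0 N) 2} {ϖ : ℚ} {L : PowerSeries ℚ_[p]}

/-- **Crux 3 at a pair of the Pollack–Wake twin family, from THEOREM B's congruence and lam-b's
budget.** At an odd multiplicative Eisenstein prime `p` of `W` (`E[p]` reducible): granted Wuthrich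
2014 Thm. 16 (`hWu`, PUBLISHED), ONE datum `(f, ϖ, L, G)` with the value congruence of THEOREM B
against `c·U·∏_{ℓ∈S}(1 − γ_ℓ)` (`U ∈ Λˣ` Pollack–Wake's cuspidal unit, `S` the split multiplicative
primes `∉ {p, q}`), and an algebraic lower bound `AlgebraicLambdaGE W p k` with `Σ_{ℓ∈S} s_ℓ ≤ k` at a
non-split `p` / `≤ k + 1` at a split `p` (the trivial zero), Mazur's main conjecture
`X2.MazurMainConjectureAt W p` holds — route T (`X2.mazurMainConjectureAt_of_algebraicLambdaGE`) with
both analytic inputs `μ_an = 0`, `λ_an = Σ s_ℓ` supplied by §3. This is the per-pair shape in which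
THEOREM B would close `stub_analyticMuZero_offLocus` AND the analytic conjunct of
`stub_lambdaCount_offLocus` on the family (MEMO-9 §5). [cite: Wuthrich2014, Thm. 16 (p. 397)]
[cite: PollackWake2025, Thm. 5.12 (1)] [cite: GreenbergLNM1716, Cor. 5.6 (proof, p. 136)] -/
theorem X2.mazurMainConjectureAt_of_valueCongr_unit_of_algebraicLambdaGE
    (hWu : Wuthrich2014.thm16_charIdeal_dvd_multiplicative_of_reducible) (hp2 : p ≠ 2)
    (hmult : W.HasMultiplicativeReductionAtPrime p) (hred : ¬ W.HasIrreducibleModPGaloisRep p)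
    (hf : IsNewformOf W f) (hϖ : (ϖ : ℝ) * W.realPeriodRat = plusPeriod f)
    (hLs : W.HasSplitMultiplicativeReductionAtPrime p → IsSplitMultPAdicLFunctionOf f p L)
    (hLn : ¬ W.HasSplitMultiplicativeReductionAtPrime p → IsMultPAdicLFunctionOf f p (-1) L)
    {G : IwasawaAlgebra p} (hG : iwasawaToPowerSeries p G = PowerSeries.C ((ϖ : ℚ) : ℚ_[p]) * L)
    {U : IwasawaAlgebra p} (hU : IsUnit U) (S : Finset ℕ) (hS : ∀ ℓ ∈ S, p.Coprime ℓ ∧ 1 < ℓ)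
    {c : ℤ_[p]} (hc : IsUnit c) {n₀ : ℕ}
    (hval : ∀ m : ℕ, n₀ ≤ m → ∀ ζ : ℂ_[p], IsPrimitiveRoot ζ (p ^ (m + 1)) →
      ‖∑' k, ((algebraMap ℚ_[p] ℂ_[p]).comp (algebraMap ℤ_[p] ℚ_[p]))
          (PowerSeries.coeff k (G - PowerSeries.C c * (U * ∏ ℓ ∈ S, (1 - frobeniusSeries p ℓ)))) *
            (ζ - 1) ^ k‖ ≤ (p : ℝ)⁻¹)
    {k : ℕ} (halg : X1.TamagawaSqueeze.AlgebraicLambdaGE W p k)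
    (hkN : ¬ W.HasSplitMultiplicativeReductionAtPrime p → ∑ ℓ ∈ S, sFactor p ℓ ≤ k)
    (hkS : W.HasSplitMultiplicativeReductionAtPrime p → ∑ ℓ ∈ S, sFactor p ℓ ≤ k + 1) :
    X2.MazurMainConjectureAt W p := by
  obtain ⟨hμ0, hlam⟩ := X2.analyticMuLE_zero_and_analyticLambdaEq_sum_sFactor_of_valueCongr hp2 hf hϖ
    hLs hLn hG hU S hS hc hval
  exact X2.mazurMainConjectureAt_of_algebraicLambdaGE hWu W p hp2 hmult hred hμ0 hlam halg hkN hkS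

end RouteT

end Summit.BirchSwinnertonDyer.BirchSwinnertonDyer.Theorems.EisensteinPrimesAnalyticLambdaAbsoluteCount

end
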